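import Summits.PneNP.PneNP.Theorems.SymmetryBudgetWindowCanoniserTraj

/-!
# Window canoniser, XXIV: soundness of the value bits — ranks, leaves, individualisation nodes

Route `PneNP/SymmetryBudget`, dichotomy `WindowBarrier` (stmt-PneNP-2145) / `NoHiddenOrder` (stmt-PneNP-14781);
continuation of `…WindowCanoniserTraj.lean`.  `WCan.Data L x ord`: the value of an ORDERING `ord` of `U`
(adjacency, outside bits, colour ranks in the final colouring, positionwise); `WCan.ValidOrd`; the soundness
statement `WCan.SoundAt L x`: an OK label that reports a value reports, at every ambient vertex, the data of ONE
valid ordering of `U`.  Here: facts about ranks (`WCan.rankS`), the leaf case (`WCan.sound_leaf`) and the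
individualisation case (`WCan.sound_conn`: the lexicographically least certified candidate; its lifted colour
ranks are correct because the child's final colouring refines mine on `U`).
-/

-- `Summit.PneNP.PneNP.…` duplicates `PneNP` BY DESIGN (single-problem summit, D-0017 layout).
set_option linter.dupNamespace false

noncomputable section

namespace Summit.PneNP.PneNP.Theorems

namespace WCan

open Finset Literature.Computability.Complexity Literature.Computability.Complexity.CGCanon
  Literature.Combinatorics.SimpleGraph
open scoped Classical

variable {K r n : ℕ}

/-! ### Orderings and their data -/

section Defs

variable [NeZero n]

/-- **The value of an ordering** `ord` of `U` (positions `p < |U|` ↦ vertices): adjacency of the window graph,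
outside bits, and colour ranks in the final colouring of `L`, positionwise; positions off `U` carry no bit. -/
def Data (L : RawLab n) (x : Fin (r + n) × Fin (r + n) → Bool) (ord : ℕ → Fin n) : BIdx r n → Prop
  | .adj p q => (p : ℕ) < L.U.card ∧ (q : ℕ) < L.U.card ∧ (G x).Adj (ord p) (ord q)
  | .ext p o => (p : ℕ) < L.U.card ∧ xo x (ord p) o = true
  | .crk p j => (p : ℕ) < L.U.card ∧ rankF L x (ord p) = j

omit [NeZero n] in
/-- A VALID ORDERING of `U`: a bijection from the positions below `|U|` onto `U`. -/
def ValidOrd (U : Finset (Fin n)) (ord : ℕ → Fin n) : Prop :=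
  (∀ p < U.card, ord p ∈ U) ∧ (∀ p q, p < U.card → q < U.card → ord p = ord q → p = q) ∧ ∀ w ∈ U, ∃ p < U.card, ord p = w

/-- **Soundness at a label**: if the replay is OK and the group reports a value, then the value bits — at every
ambient vertex — are the data of one valid ordering of `U`. -/
def SoundAt (L : Lab K n) (x : Fin (r + n) × Fin (r + n) → Bool) : Prop :=
  okP L.1 x → ∀ z, NBP (r := r) L x z →
    ∃ ord, ValidOrd L.1.U ord ∧ ∀ z' b, ev x (aVbit (r := r) L z' b) = true ↔ Data L.1 x ord (bdec b)

end Defs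

/-! ### Ranks in a state -/

section Ranks

variable (S : St n)

/-- The rank of `w` in the state `S`: vertices of `W` of smaller lifted colour. -/
def rankS (w : Fin n) : ℕ := (S.W.filter fun w' => S.liftLT w' w).card

/-- Nothing lies below a vertex off `W`. -/
theorem not_liftLT_of_not_mem {w : Fin n} (hw : w ∉ S.W) (w' : Fin n) : ¬ S.liftLT w' w := by
  rintro (⟨-, h⟩ | ⟨-, h, -⟩) <;> exact hw h

/-- The lifted order is irreflexive. -/
theorem liftLT_irrefl (w : Fin n) : ¬ S.liftLT w w := by
  rw [St.liftLT_iff]; exact lt_irrefl _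

/-- Vertices of `W` with the same colour have the same rank. -/
theorem rankS_eq_of_ceq {u v : Fin n} (hu : u ∈ S.W) (hv : v ∈ S.W) (h : S.c u = S.c v) : rankS S u = rankS S v := by
  unfold rankS
  congr 1; ext w'
  simp only [mem_filter, St.liftLT_iff, liftCol_of_mem _ hu, liftCol_of_mem _ hv, h]

/-- A vertex of `W` below another has smaller rank. -/
theorem rankS_lt_of_liftLT {u v : Fin n} (hu : u ∈ S.W) (h : S.liftLT u v) : rankS S u < rankS S v := by
  unfold rankS
  apply card_lt_card
  rw [ssubset_iff_of_subset]
  · exact ⟨u, mem_filter.2 ⟨hu, h⟩, fun hu' => liftLT_irrefl S u (mem_filter.1 hu').2⟩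
  · intro w' hw'
    rw [mem_filter] at hw' ⊢
    refine ⟨hw'.1, ?_⟩
    rw [St.liftLT_iff] at hw' h ⊢
    exact hw'.2.trans h

/-- Vertices of `W` with the same rank have the same colour. -/
theorem ceq_of_rankS_eq {u v : Fin n} (hu : u ∈ S.W) (hv : v ∈ S.W) (h : rankS S u = rankS S v) : S.c u = S.c v := by
  by_contra hne
  rcases lt_or_gt_of_ne hne with hlt | hlt
  · exact absurd h (rankS_lt_of_liftLT S hu ((S.liftLT_of_mem hu hv).2 hlt)).ne
  · exact absurd h (rankS_lt_of_liftLT S hv ((S.liftLT_of_mem hv hu).2 hlt)).ne'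

/-- Ranks are below `n`. -/
theorem rankS_lt [NeZero n] (w : Fin n) : rankS S w < n := by
  unfold rankS
  by_cases hw : w ∈ S.W
  · calc (S.W.filter fun w' => S.liftLT w' w).card < S.W.card :=
          card_lt_card ((filter_ssubset).2 ⟨w, hw, liftLT_irrefl S w⟩)
      _ ≤ n := (card_le_univ _).trans_eq (by simp)
  · rw [filter_eq_empty_iff.2 fun w' _ => not_liftLT_of_not_mem S hw w', card_empty]; exact NeZero.pos n

/-- Equal colours (no strict inequality either way) means equal rank, for vertices of `W` or not. -/
theorem rankS_eq_of_not_lt {u v : Fin n} (h1 : ¬ S.liftLT u v) (h2 : ¬ S.liftLT v u) : rankS S u = rankS S v := by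
  have he := (S.not_liftLT_iff).1 ⟨h1, h2⟩
  unfold rankS; congr 1; ext w'
  simp only [mem_filter, St.liftLT_iff, he]

end Ranks

variable [NeZero n] {x : Fin (r + n) × Fin (r + n) → Bool} (hn : 2 ≤ n)

omit [NeZero n] in
/-- `rankF` is the rank in the final state. -/
theorem rankF_eq (L : RawLab n) (w : Fin n) : rankF L x w = rankS (finSt L x) w := rfl

/-! ### Child labels, unpacked -/

omit [NeZero n] in
/-- Decoding an encoded value index. -/
@[simp] theorem bdec_benc (i : BIdx r n) : bdec (benc i) = i := by
  cases i <;> simp [bdec, benc]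

omit [NeZero n] in
/-- A defined candidate child. -/
theorem candLab_spec {L Lc : Lab K n} {xv : Fin n} {h : Fin (n + 1)} (hc : candLab L xv h = some Lc) :
    Lc.1 = L.1.cand xv h ∧ xv ∉ L.1.X := by
  unfold candLab at hc
  split_ifs at hc with hx
  cases hc
  exact ⟨rfl, hx.1⟩

omit [NeZero n] in
/-- A defined part child. -/
theorem partLab_spec {L Lc : Lab K n} {U' : Finset (Fin n)} (hc : partLab L U' = some Lc) :
    Lc.1 = L.1.part U' ∧ U' ⊂ L.1.U ∧ U'.Nonempty := by
  unfold partLab at hc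
  split_ifs at hc with hx
  cases hc
  exact ⟨rfl, hx.1, hx.2⟩

/-! ### Leaves -/

/-- **Soundness at a leaf label.** -/
theorem sound_leaf (L : Lab K n) (hU : L.1.U.card ≤ 1) : SoundAt (r := r) L x := by
  intro hok z _
  obtain ⟨hW, -⟩ := finSt_eq_of_okP L.1 x hok
  rcases Nat.le_one_iff_eq_zero_or_eq_one.1 hU with h0 | h1
  · refine ⟨fun _ => ⟨0, NeZero.pos n⟩, ⟨fun p hp => by omega, fun p q hp => by omega, fun w hw => ?_⟩, fun z' b => ?_⟩
    · rw [card_eq_zero.1 h0] at hw; simp at hw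
    · rw [ev_aVbit_leaf hU]
      constructor
      · rintro ⟨h, -⟩; omega
      · intro hd; rcases hb : bdec b with ⟨p, q⟩ | ⟨p, o⟩ | ⟨p, j⟩ <;> rw [hb] at hd <;> simp only [Data] at hd <;> omega
  · obtain ⟨u₀, hu₀⟩ := card_eq_one.1 h1
    have hch : Classical.choose (Finset.card_eq_one.1 h1) = u₀ := by
      have hmem : u₀ ∈ ({Classical.choose (Finset.card_eq_one.1 h1)} : Finset (Fin n)) := by
        rw [← Classical.choose_spec (Finset.card_eq_one.1 h1), hu₀]; exact mem_singleton_self _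
      exact (mem_singleton.1 hmem).symm
    refine ⟨fun _ => u₀, ⟨fun p hp => by simp [hu₀], fun p q hp hq _ => by omega, fun w hw => ⟨0, by omega, ?_⟩⟩, fun z' b => ?_⟩
    · rw [hu₀, mem_singleton] at hw; exact hw.symm
    · rw [ev_aVbit_leaf hU]
      simp only [h1, exists_true_left, hch]
      have hrank : rankF L.1 x u₀ = 0 := by
        rw [rankF_eq, rankS, filter_eq_empty_iff.2, card_empty]
        intro w' hw'
        rw [hW, hu₀, mem_singleton] at hw'
        rw [hw']; exact liftLT_irrefl _ u₀
      rcases bdec b with ⟨p, q⟩ | ⟨p, o⟩ | ⟨p, j⟩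
      · simp only [leafP, Data, h1, false_iff, not_and]; intro hp hq; simp
      · simp only [leafP, Data, h1, Nat.lt_one_iff]
      · simp only [leafP, Data, h1, Nat.lt_one_iff, hrank]
        exact ⟨fun ⟨hp, hj⟩ => ⟨hp, by omega⟩, fun ⟨hp, hj⟩ => ⟨hp, by omega⟩⟩

/-! ### Individualisation nodes -/

/-- A least certified candidate exists and is best; all best candidates carry its lifted vector. -/
theorem exists_best {L : Lab K n} (h : ∃ κ, certP (r := r) L x κ) :
    ∃ κ₀, bestP (r := r) L x κ₀ ∧ ∀ b, (∃ κ, bestP (r := r) L x κ ∧ lvec L x κ b = true) ↔ lvec L x κ₀ b = true := by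
  obtain ⟨κ₁, hκ₁⟩ := h
  obtain ⟨κ₀, hκ₀, hmin⟩ := exists_min_image (univ.filter fun κ => certP (r := r) L x κ) (fun κ => toLex (lvec L x κ))
    ⟨κ₁, mem_filter.2 ⟨mem_univ _, hκ₁⟩⟩
  have hbest : bestP (r := r) L x κ₀ := ⟨(mem_filter.1 hκ₀).2, fun κ' hc => hmin κ' (mem_filter.2 ⟨mem_univ _, hc⟩)⟩
  refine ⟨κ₀, hbest, fun b => ⟨?_, fun hl => ⟨κ₀, hbest, hl⟩⟩⟩
  rintro ⟨κ, hb, hl⟩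
  have := le_antisymm (hb.2 κ₀ hbest.1) (hbest.2 κ hb.1)
  rw [toLex_inj] at this
  rw [← this]; exact hl

include hn in
/-- **Lifted ranks are correct.**  For a certified candidate child `Lc` with ordering `ord`: my rank of the
vertex at position `p` is read correctly through the child's ranks, because the child's final colouring refines
my final colouring on `U`. -/
theorem lcrk_correct {L Lc : Lab K n} {xv : Fin n} {h : Fin (n + 1)} (hc : candLab L xv h = some Lc)
    (hok : okP L.1 x) (hthru : thruR L.1 Lc.1 x false xv) (hokc : okP Lc.1 x) {ord : ℕ → Fin n} (hvalid : ValidOrd Lc.1.U ord)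
    (hdata : ∀ z' b, ev x (aVbit (r := r) Lc z' b) = true ↔ Data Lc.1 x ord (bdec b)) (p j : Fin n) :
    ev x (aLcrk L (xv, h) p j) = true ↔ Data L.1 x ord (.crk p j) := by
  obtain ⟨hLc, -⟩ := candLab_spec hc
  have hUc : Lc.1.U = L.1.U := by rw [hLc]; rfl
  obtain ⟨hW, -⟩ := finSt_eq_of_okP L.1 x hok
  obtain ⟨hWc, -⟩ := finSt_eq_of_okP Lc.1 x hokc
  obtain ⟨it, hit, hSt, -, -⟩ := hthru
  -- the kernel argument: equal child ranks on `U` give equal ranks of mine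
  have key : ∀ w ∈ L.1.U, ∀ w' ∈ L.1.U, rankF Lc.1 x w = rankF Lc.1 x w' → rankF L.1 x w = rankF L.1 x w' := by
    intro w hw w' hw' he
    rw [rankF_eq, rankF_eq] at he ⊢
    have hce := ceq_of_rankS_eq _ (by rw [hWc, hUc]; exact hw) (by rw [hWc, hUc]; exact hw') he
    have hce' := rs_ker Lc.1 x hit.le (u := w) (v := w') (by show w ∈ (finSt Lc.1 x).W; rw [hWc, hUc]; exact hw)
      (by show w' ∈ (finSt Lc.1 x).W; rw [hWc, hUc]; exact hw') hce
    have hwi : w ∈ (rs Lc.1 x it).W := by rw [hSt.1, hW]; exact hw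
    have hwi' : w' ∈ (rs Lc.1 x it).W := by rw [hSt.1, hW]; exact hw'
    have h1 : ¬ (rs Lc.1 x it).liftLT w w' := by rw [St.liftLT_of_mem _ hwi hwi', hce']; exact lt_irrefl _
    have h2 : ¬ (rs Lc.1 x it).liftLT w' w := by rw [St.liftLT_of_mem _ hwi' hwi, hce']; exact lt_irrefl _
    rw [hSt.2.2] at h1 h2
    exact rankS_eq_of_not_lt _ h1 h2
  rw [ev_aLcrk hn, decide_eq_true_iff]
  simp only [ev_aPcand hn, decide_eq_true_iff, hc, Option.some.injEq, exists_eq_left', hdata, bdec_benc, Data, hUc]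
  constructor
  · rintro ⟨w, ⟨j', ⟨hp, hr⟩, hrw, hwW⟩, hj⟩
    rw [hWc, hUc] at hwW
    refine ⟨hp, ?_⟩
    rw [← hj]
    exact (key w hwW (ord p) (hUc ▸ hvalid.1 p (hUc.symm ▸ hp)) (by rw [hrw, hr])).symm
  · rintro ⟨hp, hj⟩
    have hop : ord p ∈ L.1.U := hUc ▸ hvalid.1 p (hUc.symm ▸ hp)
    refine ⟨ord p, ⟨⟨rankF Lc.1 x (ord p), rankS_lt _ _⟩, ⟨hp, rfl⟩, rfl, by rw [hWc, hUc]; exact hop⟩, hj⟩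

include hn in
/-- **Soundness at an individualisation node** (final state connected), given soundness of the smaller labels. -/
theorem sound_conn (L : Lab K n) (hU : ¬ L.1.U.card ≤ 1) (hconn : IsConn (G x) (finSt L.1 x).W (finSt L.1 x).c)
    (IH : ∀ Lc : Lab K n, Lc.1.M < L.1.M → SoundAt (r := r) Lc x) : SoundAt (r := r) L x := by
  intro hok z hNB
  rw [NBP_iff hn] at hNB
  rcases hNB with h | ⟨-, hex⟩ | ⟨h, -⟩
  · exact absurd h hU
  swap
  · exact absurd hconn h
  obtain ⟨κ₀, hbest, hbits⟩ := exists_best hex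
  obtain ⟨xv, h⟩ := κ₀
  have hcert := hbest.1
  rw [certP, ev_aCert_inl hn, decide_eq_true_iff] at hcert
  obtain ⟨Lc, hc, hthru, hokc, hNBc⟩ := hcert
  obtain ⟨hLc, -⟩ := candLab_spec hc
  have hUc : Lc.1.U = L.1.U := by rw [hLc]; rfl
  obtain ⟨ord, hvalid, hdata⟩ := IH Lc (M_candLab_lt L hc) hokc xv hNBc
  refine ⟨ord, hUc ▸ hvalid, fun z' b => ?_⟩
  rw [ev_aVbit_main hn hU]
  simp only [hconn, not_true_eq_false, false_and, or_false, true_and, hbits]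
  show inRng L.1.U (bdec b) ∧ ev x (lbitA L (xv, h) b) = true ↔ Data L.1 x ord (bdec b)
  rcases hb : bdec b with ⟨p, q⟩ | ⟨p, o⟩ | ⟨p, j⟩
  · simp only [lbitA, hb, hc, inRng, hdata, Data, hUc]; tauto
  · simp only [lbitA, hb, hc, inRng, hdata, Data, hUc]; tauto
  · simp only [lbitA, hb, inRng]
    rw [lcrk_correct hn hc hok hthru hokc hvalid hdata p j]
    simp only [Data]; tauto

end WCan

end Summit.PneNP.PneNP.Theorems

end
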